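import Literature.NumberTheory.ModularForms.HeckeOperatorsLevelOnePrimePowers
import Literature.NumberTheory.ModularForms.HeckeOperatorsLevelOneEisenstein
import HarnessLib

/-!
# `T(n) E_k = σ_{k−1}(n) E_k` for every `n ≥ 1` (Serre, Ch. VII §5.5; Eie §3.3)

J.-P. Serre, *A Course in Arithmetic* (GTM 7), Ch. VII §5.5 a) (held copy `book:serre1973-course-arithmetic`, p0088), after
proving `T(p)G_k = σ_{2k−1}(p)G_k` by the lattice argument (Eie 2008 §3.3 p. 31 prints the same computation): "This also
shows that the eigenvalues of `T(n)` are `σ_{2k−1}(n)`."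

The passage from primes to all `n` is the standard one: the `T(n)` are generated by the `T(p)` through
`T(m)T(n) = T(mn)` (`(m,n) = 1`) and `T(p)T(p^{r+1}) = T(p^{r+2}) + p^{k−1}T(p^r)` (Eie §3.3 properties (1), (2); files
`HeckeOperatorsLevelOneEigenforms`, `HeckeOperatorsLevelOnePrimePowers`), and `n ↦ σ_{k−1}(n)` satisfies the same relations
(`isMultiplicative_sigma`, `sigma_prime_pow_add_two`). Weight normalisation: Mathlib's `ModularForm.E hk` has weight `k`
(Serre writes `2k`).

## Contents

* `heckeT_prime_pow_eisensteinE` — `T(p^a) E_k = σ_{k−1}(p^a) E_k`;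
* **`heckeT_eisensteinE_eq_sigma_smul`** — `T(n) E_k = σ_{k−1}(n) E_k` for all `n ≥ 1`.

## References

* [Serre1973] J.-P. Serre, *A Course in Arithmetic*, GTM 7 (1973), Ch. VII §5.5 a) (held p0088).
* [Eie2008] M. Eie, *Topics in Number Theory*, World Scientific (2009), §3.3 (p. 31; properties (1), (2)).
-/

noncomputable section

open scoped MatrixGroups Real Manifold ModularForm
open Complex ArithmeticFunction
open UpperHalfPlane hiding I

namespace Literature.NumberTheory.ModularForms

/-- **`T(p^a) E_k = σ_{k−1}(p^a) E_k`** (`p` prime), by induction on `a` from `T(p)E_k = (1 + p^{k−1})E_k` and Eie's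
property (2). [cite: Serre1973, Ch. VII §5.5 a)] [cite: Eie2008, §3.3 (p. 31 and property (2))] -/
theorem heckeT_prime_pow_eisensteinE {k : ℕ} (hk : 3 ≤ k) (hk2 : Even k) {p : ℕ} (hp : p.Prime) (a : ℕ) :
    heckeT (pow_pos hp.pos a) (ModularForm.E hk) = ((sigma (k - 1) (p ^ a) : ℕ) : ℂ) • ModularForm.E hk := by
  have hzpow : ((p : ℂ)) ^ ((k : ℤ) - 1) = (p : ℂ) ^ (k - 1) := by
    rw [show ((k : ℤ) - 1) = ((k - 1 : ℕ) : ℤ) by omega, zpow_natCast]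
  induction a using Nat.strong_induction_on with
  | _ a ih =>
    match a with
    | 0 =>
      rw [heckeT_congr (pow_pos hp.pos 0) one_pos (pow_zero p), heckeT_one, pow_zero, sigma_one, Nat.cast_one, one_smul]
    | 1 =>
      rw [heckeT_congr (pow_pos hp.pos 1) hp.pos (pow_one p), heckeT_eisensteinE hk hk2 hp, pow_one, sigma_prime (k - 1) hp]
      push_cast
      rfl
    | a + 2 =>
      have hrec : heckeT (pow_pos hp.pos (a + 2)) (ModularForm.E hk) =
          heckeT hp.pos (heckeT (pow_pos hp.pos (a + 1)) (ModularForm.E hk)) -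
            ((p : ℂ) ^ ((k : ℤ) - 1)) • heckeT (pow_pos hp.pos a) (ModularForm.E hk) := by
        rw [heckeT_prime_heckeT_prime_pow hp a (ModularForm.E hk), add_sub_cancel_right]
      rw [hrec, ih (a + 1) (by omega), ih a (by omega), heckeT_smul, heckeT_eisensteinE hk hk2 hp, smul_smul, smul_smul,
        ← sub_smul, hzpow]
      congr 1
      have h := congrArg (Nat.cast : ℕ → ℂ) (sigma_prime_pow_add_two (k - 1) hp a)
      push_cast at h
      linear_combination -h

/-- **`T(n) E_k = σ_{k−1}(n) E_k` for every `n ≥ 1`**: the level-one Eisenstein series `E_k` (`k ≥ 4` even, Mathlib's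
normalisation) is a simultaneous Hecke eigenform with eigenvalues `σ_{k−1}(n)` — Serre: "This also shows that the eigenvalues
of `T(n)` are `σ_{2k−1}(n)`." [cite: Serre1973, Ch. VII §5.5 a)] [cite: Eie2008, §3.3 (p. 31; properties (1), (2))] -/
theorem heckeT_eisensteinE_eq_sigma_smul {k : ℕ} (hk : 3 ≤ k) (hk2 : Even k) {n : ℕ} (hn : 0 < n) :
    heckeT hn (ModularForm.E hk) = ((sigma (k - 1) n : ℕ) : ℂ) • ModularForm.E hk := by
  induction n using Nat.recOnPosPrimePosCoprime with
  | prime_pow p a hp ha => exact heckeT_prime_pow_eisensteinE hk hk2 hp a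
  | zero => exact absurd hn (lt_irrefl 0)
  | one => rw [heckeT_one, sigma_one, Nat.cast_one, one_smul]
  | coprime c d hc hd hcd ihc ihd =>
    have hc0 : 0 < c := by omega
    have hd0 : 0 < d := by omega
    rw [← heckeT_heckeT_of_coprime hc0 hd0 hcd, ihd hd0, heckeT_smul, ihc hc0, smul_smul,
      isMultiplicative_sigma.map_mul_of_coprime hcd, Nat.cast_mul, mul_comm]

end Literature.NumberTheory.ModularForms
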